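import Summits.NavierStokesRegularity.TurbBounds.CouetteTailSeq
import Summits.NavierStokesRegularity.TurbBounds.ShearBridgeNormsTF
import HarnessLib

/-!
# Two-field (plane Couette) pieces as forms of the coefficient vectors `(c; d)`: the selection projection, the block forms, the tail-form dictionary

Cell `turb-bounds` (pub-turb), shear lane, pub-turb-shear gen 6 (2026-08-22); v2 lane. Preparations for `CouetteModeAssembly`:
* `keepFun`, `keepIdx_getD`, `length_keepIdx` — the kept indices `2…LW−1, LW+1…LW+LT−1` explicitly; `fullVec LW c d` — the stacked vector `(c; d)`;
* `sum_keep` — a sum over all `r < LW+LT` of a function vanishing at the three dropped indices `0, 1, LW` equals the sum over the kept ones;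
* `qform_selectTab` — `ψᵀ (selectTab Mf) ψ = Σ_{r,s<LW+LT} u_r Mf(r,s) u_s` for `u = (c; d)` with `c 0 = c 1 = 0`, `d 0 = 0` (the wall conditions at `x = +1`,
  SPEC 3.3) and `ψ_i = u_{keep i}`;
* `form_blockDiag`, `form_offSym` — `uᵀ(A ⊕ B)u = cᵀAc + dᵀBd`, `uᵀ[E]_sym u = 2·cᵀEd`;
* `gw0_form`, `gt0_form`, `hw_form`, `ht_form` — the table forms of `GW0, GT0, HW, HT` as the explicit tracked tail expressions of `CouetteTailSeq`.
PURE ALGEBRA. HONEST FRAMING: rigorous bounds for the stated PDE and boundary conditions; no claim about physical turbulence beyond the bound.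
-/

set_option linter.style.longLine false

namespace Summit.NavierStokesRegularity.TurbBounds.ShearSpecPiecesTF

open Finset Summit.NavierStokesRegularity.TurbBounds.LadderTail Summit.NavierStokesRegularity.TurbBounds.ShearTailSeq
  Summit.NavierStokesRegularity.TurbBounds.ShearSpecPieces

/-! ### kept indices -/

/-- The `i`-th kept full index: `i+2` (c-part, `i < N+P+1`) or `i+3` (d-part). -/
def keepFun (N P i : ℕ) : ℕ := if i < N + P + 1 then i + 2 else i + 3

/-- `|keepIdx| = 2(N+P+1)`. -/
theorem length_keepIdx (N P : ℕ) : (keepIdx N P).length = 2 * (N + P + 1) := by simp [keepIdx]; ring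

/-- `keepIdx[i] = keepFun i` for `i < 2(N+P+1)`. -/
theorem keepIdx_getD (N P i : ℕ) (hi : i < 2 * (N + P + 1)) : (keepIdx N P).getD i 0 = keepFun N P i := by
  unfold keepIdx keepFun
  by_cases h : i < N + P + 1
  · rw [List.getD_append _ _ _ _ (by simpa using h), getD_map_range, if_pos h, if_pos h]
  · rw [List.getD_append_right _ _ _ _ (by simpa using not_lt.mp h), List.length_map, List.length_range, getD_map_range,
      if_pos (by omega), if_neg h]
    omega

/-- The stacked vector `u = (c; d)`: `u_r = c_r` for `r < LW`, `d_{r−LW}` beyond. -/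
def fullVec (LW : ℕ) (c d : ℕ → ℝ) (r : ℕ) : ℝ := if r < LW then c r else d (r - LW)

/-- **Sum over all indices = sum over kept indices** when the summand vanishes at the dropped indices `0, 1, LW` (`LW = N+P+3`, `LW + LT = 2N+2P+5`). -/
theorem sum_keep (N P : ℕ) (g : ℕ → ℝ) (h0 : g 0 = 0) (h1 : g 1 = 0) (hLW : g (N + P + 3) = 0) :
    ∑ r ∈ range (2 * N + 2 * P + 5), g r = ∑ i ∈ range (2 * (N + P + 1)), g (keepFun N P i) := by
  have hl : ∑ r ∈ range (2 * N + 2 * P + 5), g r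
      = ∑ r ∈ range 2, g r + ∑ k ∈ range (N + P + 1), g (2 + k) + ∑ k ∈ range 1, g (N + P + 3 + k) + ∑ k ∈ range (N + P + 1), g (N + P + 4 + k) := by
    rw [show 2 * N + 2 * P + 5 = ((2 + (N + P + 1)) + 1) + (N + P + 1) by ring, Finset.sum_range_add, Finset.sum_range_add, Finset.sum_range_add]
    have e3 : ∑ k ∈ range 1, g (2 + (N + P + 1) + k) = ∑ k ∈ range 1, g (N + P + 3 + k) :=
      Finset.sum_congr rfl fun k _ => by rw [show 2 + (N + P + 1) + k = N + P + 3 + k by ring]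
    have e4 : ∑ k ∈ range (N + P + 1), g (2 + (N + P + 1) + 1 + k) = ∑ k ∈ range (N + P + 1), g (N + P + 4 + k) :=
      Finset.sum_congr rfl fun k _ => by rw [show 2 + (N + P + 1) + 1 + k = N + P + 4 + k by ring]
    rw [e3, e4]
  have hr : ∑ i ∈ range (2 * (N + P + 1)), g (keepFun N P i)
      = ∑ k ∈ range (N + P + 1), g (2 + k) + ∑ k ∈ range (N + P + 1), g (N + P + 4 + k) := by
    rw [two_mul, Finset.sum_range_add]
    unfold keepFun
    congr 1
    · exact Finset.sum_congr rfl fun k hk => by rw [if_pos (by simpa using hk), add_comm]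
    · exact Finset.sum_congr rfl fun k _ => by rw [if_neg (by omega), show N + P + 1 + k + 3 = N + P + 4 + k by ring]
  rw [hl, hr]
  simp [Finset.sum_range_succ, h0, h1, hLW]

/-- **The selection projection as a form identity.** For `u = (c; d)` with `c 0 = c 1 = 0`, `d 0 = 0` and `ψ_i = u_{keepFun i}`:
`ψᵀ (selectTab N P Mf) ψ = Σ_{r,s < LW+LT} u_r · Mf r s · u_s`. -/
theorem qform_selectTab (N P : ℕ) (Mf : ℕ → ℕ → ℚ) {c d : ℕ → ℝ} (hc0 : c 0 = 0) (hc1 : c 1 = 0) (hd0 : d 0 = 0) :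
    qform (selectTab N P Mf) (2 * (N + P + 1)) (fun i => fullVec (N + P + 3) c d (keepFun N P i))
      = ∑ r ∈ range (2 * N + 2 * P + 5), ∑ s ∈ range (2 * N + 2 * P + 5),
          fullVec (N + P + 3) c d r * (Mf r s : ℝ) * fullVec (N + P + 3) c d s := by
  have hu0 : fullVec (N + P + 3) c d 0 = 0 := by unfold fullVec; rw [if_pos (by omega)]; exact hc0
  have hu1 : fullVec (N + P + 3) c d 1 = 0 := by unfold fullVec; rw [if_pos (by omega)]; exact hc1
  have huL : fullVec (N + P + 3) c d (N + P + 3) = 0 := by unfold fullVec; rw [if_neg (lt_irrefl _), Nat.sub_self]; exact hd0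
  unfold qform bform
  rw [sum_keep N P _ (by simp [hu0]) (by simp [hu1]) (by simp [huL])]
  refine Finset.sum_congr rfl fun i hi => ?_
  rw [sum_keep N P _ (by simp [hu0]) (by simp [hu1]) (by simp [huL])]
  refine Finset.sum_congr rfl fun j hj => ?_
  have hi' : i < 2 * (N + P + 1) := by simpa using hi
  have hj' : j < 2 * (N + P + 1) := by simpa using hj
  rw [get2_selectTab, length_keepIdx, if_pos ⟨hi', hj'⟩, keepIdx_getD N P i hi', keepIdx_getD N P j hj']

/-! ### block forms on the stacked vector -/

/-- **`uᵀ (A ⊕ B) u = cᵀ A c + dᵀ B d`** (`u = (c; d)`, `A : LW × LW`, `B : LT × LT`). -/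
theorem form_blockDiag (LW LT : ℕ) (A B : List (List ℚ)) (c d : ℕ → ℝ) :
    ∑ r ∈ range (LW + LT), ∑ s ∈ range (LW + LT), fullVec LW c d r * (blockDiag LW A B r s : ℝ) * fullVec LW c d s
      = qform A LW c + qform B LT d := by
  -- the double sum over `range (LW + LT)` in four blocks (kept local: a generic top-level copy would be a near-duplicate, decision 120 (C))
  have sum_sum_blocks : ∀ F : ℕ → ℕ → ℝ, ∑ r ∈ range (LW + LT), ∑ s ∈ range (LW + LT), F r s
      = ∑ r ∈ range LW, ∑ s ∈ range LW, F r s + ∑ r ∈ range LW, ∑ s ∈ range LT, F r (LW + s)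
        + (∑ r ∈ range LT, ∑ s ∈ range LW, F (LW + r) s + ∑ r ∈ range LT, ∑ s ∈ range LT, F (LW + r) (LW + s)) := by
    intro F
    rw [Finset.sum_range_add]
    simp only [Finset.sum_range_add, Finset.sum_add_distrib]
  rw [sum_sum_blocks]
  unfold qform bform blockDiag fullVec
  have h1 : ∀ r ∈ range LW, ∀ s ∈ range LW,
      (if r < LW then c r else d (r - LW)) * ((if r < LW ∧ s < LW then get2 A r s else if LW ≤ r ∧ LW ≤ s then get2 B (r - LW) (s - LW) else 0 : ℚ) : ℝ)
        * (if s < LW then c s else d (s - LW)) = c r * (get2 A r s : ℝ) * c s := by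
    intro r hr s hs
    have hr' : r < LW := by simpa using hr
    have hs' : s < LW := by simpa using hs
    rw [if_pos hr', if_pos hs', if_pos ⟨hr', hs'⟩]
  have h2 : ∀ r ∈ range LW, ∀ s ∈ range LT,
      (if r < LW then c r else d (r - LW)) * ((if r < LW ∧ LW + s < LW then get2 A r (LW + s) else if LW ≤ r ∧ LW ≤ LW + s then get2 B (r - LW) (LW + s - LW) else 0 : ℚ) : ℝ)
        * (if LW + s < LW then c (LW + s) else d (LW + s - LW)) = 0 := by
    intro r hr s _
    have hr' : r < LW := by simpa using hr
    rw [if_neg (show ¬(r < LW ∧ LW + s < LW) from fun h => by omega), if_neg (show ¬(LW ≤ r ∧ LW ≤ LW + s) from fun h => by omega)]; simp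
  have h3 : ∀ r ∈ range LT, ∀ s ∈ range LW,
      (if LW + r < LW then c (LW + r) else d (LW + r - LW)) * ((if LW + r < LW ∧ s < LW then get2 A (LW + r) s else if LW ≤ LW + r ∧ LW ≤ s then get2 B (LW + r - LW) (s - LW) else 0 : ℚ) : ℝ)
        * (if s < LW then c s else d (s - LW)) = 0 := by
    intro r _ s hs
    have hs' : s < LW := by simpa using hs
    rw [if_neg (show ¬(LW + r < LW ∧ s < LW) from fun h => by omega), if_neg (show ¬(LW ≤ LW + r ∧ LW ≤ s) from fun h => by omega)]; simp
  have h4 : ∀ r ∈ range LT, ∀ s ∈ range LT,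
      (if LW + r < LW then c (LW + r) else d (LW + r - LW)) * ((if LW + r < LW ∧ LW + s < LW then get2 A (LW + r) (LW + s)
        else if LW ≤ LW + r ∧ LW ≤ LW + s then get2 B (LW + r - LW) (LW + s - LW) else 0 : ℚ) : ℝ)
        * (if LW + s < LW then c (LW + s) else d (LW + s - LW)) = d r * (get2 B r s : ℝ) * d s := by
    intro r _ s _
    rw [if_neg (by omega), if_neg (fun h => by omega), if_pos ⟨by omega, by omega⟩, if_neg (by omega), Nat.add_sub_cancel_left, Nat.add_sub_cancel_left]
  rw [Finset.sum_congr rfl fun r hr => Finset.sum_congr rfl fun s hs => h1 r hr s hs,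
    Finset.sum_congr rfl fun r hr => Finset.sum_congr rfl fun s hs => h2 r hr s hs,
    Finset.sum_congr rfl fun r hr => Finset.sum_congr rfl fun s hs => h3 r hr s hs,
    Finset.sum_congr rfl fun r hr => Finset.sum_congr rfl fun s hs => h4 r hr s hs]
  simp

/-- **`uᵀ [E]_sym u = 2·cᵀ E d`** (`E : LW × LT`). -/
theorem form_offSym (LW LT : ℕ) (E : List (List ℚ)) (c d : ℕ → ℝ) :
    ∑ r ∈ range (LW + LT), ∑ s ∈ range (LW + LT), fullVec LW c d r * (offSym LW E r s : ℝ) * fullVec LW c d s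
      = 2 * rform E LW LT c d := by
  -- the double sum over `range (LW + LT)` in four blocks (kept local: a generic top-level copy would be a near-duplicate, decision 120 (C))
  have sum_sum_blocks : ∀ F : ℕ → ℕ → ℝ, ∑ r ∈ range (LW + LT), ∑ s ∈ range (LW + LT), F r s
      = ∑ r ∈ range LW, ∑ s ∈ range LW, F r s + ∑ r ∈ range LW, ∑ s ∈ range LT, F r (LW + s)
        + (∑ r ∈ range LT, ∑ s ∈ range LW, F (LW + r) s + ∑ r ∈ range LT, ∑ s ∈ range LT, F (LW + r) (LW + s)) := by
    intro F
    rw [Finset.sum_range_add]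
    simp only [Finset.sum_range_add, Finset.sum_add_distrib]
  rw [sum_sum_blocks]
  unfold rform offSym fullVec
  have h1 : ∀ r ∈ range LW, ∀ s ∈ range LW,
      (if r < LW then c r else d (r - LW)) * ((if r < LW ∧ LW ≤ s then get2 E r (s - LW) else if LW ≤ r ∧ s < LW then get2 E s (r - LW) else 0 : ℚ) : ℝ)
        * (if s < LW then c s else d (s - LW)) = 0 := by
    intro r hr s hs
    have hr' : r < LW := by simpa using hr
    have hs' : s < LW := by simpa using hs
    rw [if_neg (show ¬(r < LW ∧ LW ≤ s) from fun h => by omega), if_neg (show ¬(LW ≤ r ∧ s < LW) from fun h => by omega)]; simp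
  have h2 : ∀ r ∈ range LW, ∀ s ∈ range LT,
      (if r < LW then c r else d (r - LW)) * ((if r < LW ∧ LW ≤ LW + s then get2 E r (LW + s - LW) else if LW ≤ r ∧ LW + s < LW then get2 E (LW + s) (r - LW) else 0 : ℚ) : ℝ)
        * (if LW + s < LW then c (LW + s) else d (LW + s - LW)) = c r * (get2 E r s : ℝ) * d s := by
    intro r hr s _
    have hr' : r < LW := by simpa using hr
    rw [if_pos hr', if_pos ⟨hr', by omega⟩, if_neg (by omega), Nat.add_sub_cancel_left]
  have h3 : ∀ r ∈ range LT, ∀ s ∈ range LW,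
      (if LW + r < LW then c (LW + r) else d (LW + r - LW)) * ((if LW + r < LW ∧ LW ≤ s then get2 E (LW + r) (s - LW) else if LW ≤ LW + r ∧ s < LW then get2 E s (LW + r - LW) else 0 : ℚ) : ℝ)
        * (if s < LW then c s else d (s - LW)) = d r * (get2 E s r : ℝ) * c s := by
    intro r _ s hs
    have hs' : s < LW := by simpa using hs
    rw [if_neg (by omega), if_neg (fun h => by omega), if_pos ⟨by omega, hs'⟩, if_pos hs', Nat.add_sub_cancel_left]
  have h4 : ∀ r ∈ range LT, ∀ s ∈ range LT,
      (if LW + r < LW then c (LW + r) else d (LW + r - LW)) * ((if LW + r < LW ∧ LW ≤ LW + s then get2 E (LW + r) (LW + s - LW)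
        else if LW ≤ LW + r ∧ LW + s < LW then get2 E (LW + s) (LW + r - LW) else 0 : ℚ) : ℝ)
        * (if LW + s < LW then c (LW + s) else d (LW + s - LW)) = 0 := by
    intro r _ s _
    rw [if_neg (show ¬(LW + r < LW ∧ LW ≤ LW + s) from fun h => by omega), if_neg (show ¬(LW ≤ LW + r ∧ LW + s < LW) from fun h => by omega)]; simp
  rw [Finset.sum_congr rfl fun r hr => Finset.sum_congr rfl fun s hs => h1 r hr s hs,
    Finset.sum_congr rfl fun r hr => Finset.sum_congr rfl fun s hs => h2 r hr s hs,
    Finset.sum_congr rfl fun r hr => Finset.sum_congr rfl fun s hs => h3 r hr s hs,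
    Finset.sum_congr rfl fun r hr => Finset.sum_congr rfl fun s hs => h4 r hr s hs]
  simp only [Finset.sum_const_zero, zero_add, add_zero]
  rw [Finset.sum_comm (f := fun r s => d r * (get2 E s r : ℝ) * c s)]
  have e : ∑ y ∈ range LW, ∑ x ∈ range LT, d x * (get2 E y x : ℝ) * c y = ∑ i ∈ range LW, ∑ j ∈ range LT, c i * (get2 E i j : ℝ) * d j :=
    Finset.sum_congr rfl fun i _ => Finset.sum_congr rfl fun j _ => by ring
  rw [e]; ring

/-! ### the tail tables as the explicit tracked tail expressions -/

/-- **`cᵀ GW0 c = Σ_{k<P} w_{N+1+k} b_{N+1+k}²`** (`b = D0 c` via the ladders). -/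
theorem gw0_form {N P : ℕ} {c a b : ℕ → ℝ} (hA : IsLadder c a) (h0a : a 0 = c 0 - c 1 / 3) (hB : IsLadder a b) (h0b : b 0 = a 0 - a 1 / 3) :
    qform (gw0Tab N P) (N + P + 3) c = ∑ k ∈ range P, w (N + 1 + k) * b (N + 1 + k) ^ 2 := by
  rw [qform_gw0Tab]
  have h : ∀ n ∈ range (N + P + 1), (if N + 1 ≤ n then (norm2 n : ℝ) else 0) * lin (tfD0 N P) (N + P + 3) n c ^ 2
      = if N + 1 ≤ n then w n * b n ^ 2 else 0 := by
    intro n hn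
    have hn' : n < N + P + 1 := by simpa using hn
    rw [lin_tfD0_eq_ladder hA h0a hB h0b n hn']
    split_ifs <;> simp [norm2_cast]
  rw [Finset.sum_congr rfl h, show N + P + 1 = (N + 1) + P by ring, sum_indicator_window]

/-- **`dᵀ GT0 d = Σ_{k<P} w_{N+1+k} e_{N+1+k}²`** (`e = DT d`). -/
theorem gt0_form {N P : ℕ} {d e : ℕ → ℝ} (hE : IsLadder d e) (h0 : e 0 = d 0 - d 1 / 3) :
    qform (gt0Tab N P) (N + P + 2) d = ∑ k ∈ range P, w (N + 1 + k) * e (N + 1 + k) ^ 2 := by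
  rw [qform_gt0Tab]
  have h : ∀ n ∈ range (N + P + 1), (if N + 1 ≤ n then (norm2 n : ℝ) else 0) * lin (tfDT N P) (N + P + 2) n d ^ 2
      = if N + 1 ≤ n then w n * e n ^ 2 else 0 := by
    intro n hn
    have hn' : n < N + P + 1 := by simpa using hn
    rw [lin_tfDT_eq_ladder hE h0 n hn']
    split_ifs <;> simp [norm2_cast]
  rw [Finset.sum_congr rfl h, show N + P + 1 = (N + 1) + P by ring, sum_indicator_window]

/-- **`dᵀ diag(HT) d = φ_{N+P} d_{N+P}² + φ_{N+P+1} d_{N+P+1}²`**. -/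
theorem ht_form (N P : ℕ) (d : ℕ → ℝ) :
    qform (diagMat (htDiag N P)) (N + P + 2) d = phi (N + P) * d (N + P) ^ 2 + phi (N + P + 1) * d (N + P + 1) ^ 2 := by
  rw [qform_diagMat]
  have h : ∀ j ∈ range (N + P + 2), ((htDiag N P).getD j 0 : ℝ) * d j ^ 2 = if N + P ≤ j then phi j * d j ^ 2 else 0 := by
    intro j hj
    have hj' : j < N + P + 2 := by simpa using hj
    rw [getD_htDiag, if_pos hj', omega_cast]
    have e1 : (N + P + 1 ≤ j + 1) ↔ N + P ≤ j := by omega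
    rw [if_congr e1 rfl rfl, if_neg (show ¬(N + P + 1 + 1 ≤ j) by omega)]
    split_ifs <;> ring
  rw [Finset.sum_congr rfl h, show N + P + 2 = (N + P) + 2 by ring, sum_indicator_window]
  simp [Finset.sum_range_succ]

/-- **`cᵀ HW c = (φ_{N+P} a_{N+P}² + φ_{N+P+1} a_{N+P+1}²) + lam(N+P)·(φ_{N+P+1} c_{N+P+1}² + φ_{N+P+2} c_{N+P+2}²)`** (`a = D1 c`). -/
theorem hw_form {N P : ℕ} {c a : ℕ → ℝ} (hA : IsLadder c a) (h0a : a 0 = c 0 - c 1 / 3) :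
    qform (hwTab N P) (N + P + 3) c
      = (phi (N + P) * a (N + P) ^ 2 + phi (N + P + 1) * a (N + P + 1) ^ 2)
        + lam (N + P) * (phi (N + P + 1) * c (N + P + 1) ^ 2 + phi (N + P + 2) * c (N + P + 2) ^ 2) := by
  rw [qform_hwTab, tfMuW_cast]
  have h1 : ∀ j ∈ range (N + P + 3), ((omega (N + P + 2) j : ℚ) : ℝ) * c j ^ 2 = if N + P + 1 ≤ j then phi j * c j ^ 2 else 0 := by
    intro j hj
    have hj' : j < N + P + 3 := by simpa using hj
    rw [omega_cast]
    have e1 : (N + P + 2 ≤ j + 1) ↔ N + P + 1 ≤ j := by omega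
    rw [if_congr e1 rfl rfl, if_neg (show ¬(N + P + 2 + 1 ≤ j) by omega)]
    split_ifs <;> ring
  have h2 : ∀ n ∈ range (N + P + 2), ((omega (N + P + 1) n : ℚ) : ℝ) * lin (tfD1 N P) (N + P + 3) n c ^ 2 = if N + P ≤ n then phi n * a n ^ 2 else 0 := by
    intro n hn
    have hn' : n < N + P + 2 := by simpa using hn
    rw [omega_cast, lin_tfD1_eq_ladder hA h0a n hn']
    have e1 : (N + P + 1 ≤ n + 1) ↔ N + P ≤ n := by omega
    rw [if_congr e1 rfl rfl, if_neg (show ¬(N + P + 1 + 1 ≤ n) by omega)]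
    split_ifs <;> ring
  rw [Finset.sum_congr rfl h1, Finset.sum_congr rfl h2, show N + P + 3 = (N + P + 1) + 2 by ring, sum_indicator_window,
    show N + P + 2 = (N + P) + 2 by ring, sum_indicator_window]
  simp [Finset.sum_range_succ, show N + P + 1 + 1 = N + P + 2 by ring]
  ring

end Summit.NavierStokesRegularity.TurbBounds.ShearSpecPiecesTF
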